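import Summits.BirchSwinnertonDyer.BirchSwinnertonDyer.Theorems.ResidualThetaTransportAtTwoThetaLayerLambdaCongruenceAtTwoStarKTwo
import Mathlib.FieldTheory.Finiteness
import Mathlib.Algebra.Module.ZMod
import Mathlib.LinearAlgebra.Dual.Lemmas
import HarnessLib

/-!
# Crux `ThetaLayerLambdaCongruenceAtTwo` (stmt-BirchSwinnertonDyer-20688, route ResidualThetaTransportAtTwo), line
# `birth` v9, stub (C3k): B4 in QUOTIENT form («`Λ/𝔪Λ` has at most four cosets») from the SUB form `dim_{𝕋/𝔪} J₀(L)[𝔪] = 2`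
# (fact `buzzard2000_multiplicityOne_gamma0`, applied by the lead) and the Hecke self-duality of `J₀(L)[2]`
# (fact `heckeSelfDual_torsionBy_J0`) (width seat bsd-wall-rtt-p3-w3 g3; `--supports stmt-BirchSwinnertonDyer-20688 --as helper`)

HONEST FRAMING. Finite linear algebra over `𝔽₂` on the tree's analytic Jacobian `J0 L = S₂(Γ₀(L))^∨ ⧸ Λ` and its `2`-torsion;
the two multiplicity-one inputs enter as explicit hypotheses (`hsub`: the sub form, as concluded by
`buzzard2000_multiplicityOne_gamma0`; `hB`: the `𝕋`-balanced perfect pairing of `heckeSelfDual_torsionBy_J0`). No definition, no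
named fact introduced; BSD is not proved by any of this.

WHAT. With `M = J₀(L)[2] ≅ Λ/2Λ` (`Λ = periodHomology L`, via `x ↦ [x/2]`, the tree's `J0.divMap`):
* §1 `natCard_addMonoidHom_zmod_two` (`|Hom(A, ℤ/2)| = |A|` for a finite elementary abelian `2`-group),
  `exists_fourCosets_of_natCard_quotient_le_four` (a quotient of exponent `2` with at most `4` elements is covered by the
  classes of `0, v₁, v₂, v₁+v₂`);
* §2 `natCard_quotient_smul_le_natCard_torsionBySet` : `|M/𝔪M| ≤ |M[𝔪]|` from a `𝕋`-balanced pairing `B` on `M` with trivial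
  left kernel (`x ↦ B(x,·)` is then a bijection `M → Hom(M, ℤ/2)`, and `B(x,·)` kills `𝔪M` iff `x ∈ M[𝔪]`);
* §3 `exists_fourCosets_periodHomology_of_multiplicityOne` : for an ideal `𝔪 ∋ 2` of `𝕋 = HeckeRing0 L 2` with `𝔪` maximal,
  `|𝕋/𝔪| = 2` and `dim_{𝕋/𝔪} J₀(L)[𝔪] = 2` (B4, sub form) and the self-duality pairing (fact shape), THERE ARE `v₁, v₂ ∈ Λ`
  with `Λ ⊆ 𝔪Λ ∪ (v₁ + 𝔪Λ) ∪ (v₂ + 𝔪Λ) ∪ (v₁ + v₂ + 𝔪Λ)` — the hypothesis `hcos` of `…StarKTwo.kTwo_of_fourCosets_of_facts`.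

References: [DarmonDiamondTaylor1995] §1.6 Lemma 1.38, §4.5 Thm. 4.26; Lines/birth-C3k-plan.md Addendum 2.
-/

noncomputable section

-- justification: the `Summit.BirchSwinnertonDyer.BirchSwinnertonDyer.…` path repeats a component (route-file convention)
set_option linter.dupNamespace false

open scoped MatrixGroups ModularForm

open CongruenceSubgroup
open Literature.NumberTheory.EllipticCurves Literature.NumberTheory.EllipticCurves.ModularForms

namespace Summit.BirchSwinnertonDyer.BirchSwinnertonDyer.Theorems.ThetaLayerLambdaCongruenceAtTwo

/-! ## §1. Finite elementary abelian `2`-groups -/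

section Elementary

/-- **`|Hom(A, ℤ/2)| = |A|`** for a finite abelian group killed by `2` (an `𝔽₂`-vector space and its dual have the same
dimension). [folklore] -/
theorem natCard_addMonoidHom_zmod_two {A : Type*} [AddCommGroup A] [Finite A] (h2 : ∀ a : A, 2 • a = 0) :
    Nat.card (A →+ ZMod 2) = Nat.card A := by
  letI : Module (ZMod 2) A := AddCommGroup.zmodModule h2
  haveI : Module.Finite (ZMod 2) A := Module.Finite.of_finite
  rw [Nat.card_congr (AddMonoidHom.toZModLinearMapEquiv 2 (M := A) (M₁ := ZMod 2)).toEquiv]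
  change Nat.card (Module.Dual (ZMod 2) A) = Nat.card A
  rw [Module.natCard_eq_pow_finrank (K := ZMod 2) (V := Module.Dual (ZMod 2) A), Subspace.dual_finrank_eq,
    ← Module.natCard_eq_pow_finrank (K := ZMod 2) (V := A)]

/-- **Four cosets.** If `K₀ ≤ X` contains `2X` and `X/K₀` has at most four elements, then `X` is covered by the `K₀`-cosets
of `0, v₁, v₂, v₁ + v₂` for some `v₁, v₂ ∈ X` (an elementary abelian `2`-group of order `≤ 4` is `{0, q₁, q₂, q₁+q₂}`).
[folklore] -/
theorem exists_fourCosets_of_natCard_quotient_le_four {X : Type*} [AddCommGroup X] (K₀ : AddSubgroup X)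
    [Finite (X ⧸ K₀)] (h2 : ∀ x : X, (2 : ℕ) • x ∈ K₀) (hcard : Nat.card (X ⧸ K₀) ≤ 4) :
    ∃ v₁ v₂ : X, ∀ x : X, x ∈ K₀ ∨ x - v₁ ∈ K₀ ∨ x - v₂ ∈ K₀ ∨ x - (v₁ + v₂) ∈ K₀ := by
  classical
  let π : X →+ X ⧸ K₀ := QuotientAddGroup.mk' K₀
  have hπ : ∀ z, π z = 0 ↔ z ∈ K₀ := fun z ↦ QuotientAddGroup.eq_zero_iff z
  have hπsurj : Function.Surjective π := QuotientAddGroup.mk'_surjective K₀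
  have h2q : ∀ q : X ⧸ K₀, q + q = 0 := fun q ↦ by
    obtain ⟨x, rfl⟩ := hπsurj q
    rw [← map_add, hπ, ← two_nsmul]
    exact h2 x
  have hneg : ∀ q : X ⧸ K₀, -q = q := fun q ↦ by
    rw [neg_eq_iff_add_eq_zero, h2q]
  -- reduce to a statement on classes
  suffices h : ∃ q₁ q₂ : X ⧸ K₀, ∀ q : X ⧸ K₀, q = 0 ∨ q = q₁ ∨ q = q₂ ∨ q = q₁ + q₂ by
    obtain ⟨q₁, q₂, hq⟩ := h
    obtain ⟨v₁, rfl⟩ := hπsurj q₁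
    obtain ⟨v₂, rfl⟩ := hπsurj q₂
    refine ⟨v₁, v₂, fun x ↦ ?_⟩
    rcases hq (π x) with h | h | h | h
    · exact Or.inl ((hπ x).mp h)
    · exact Or.inr (Or.inl ((hπ _).mp (by rw [map_sub, h, sub_self])))
    · exact Or.inr (Or.inr (Or.inl ((hπ _).mp (by rw [map_sub, h, sub_self]))))
    · exact Or.inr (Or.inr (Or.inr ((hπ _).mp (by rw [map_sub, map_add, h, sub_self]))))
  by_cases h0 : ∀ q : X ⧸ K₀, q = 0
  · exact ⟨0, 0, fun q ↦ Or.inl (h0 q)⟩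
  push Not at h0
  obtain ⟨q₁, hq₁⟩ := h0
  by_cases h1 : ∀ q : X ⧸ K₀, q = 0 ∨ q = q₁
  · exact ⟨q₁, q₁, fun q ↦ (h1 q).imp_right Or.inl⟩
  push Not at h1
  obtain ⟨q₂, hq₂0, hq₂1⟩ := h1
  refine ⟨q₁, q₂, fun q ↦ ?_⟩
  -- the four classes `0, q₁, q₂, q₁ + q₂` are distinct, hence exhaust `X/K₀`
  haveI : Fintype (X ⧸ K₀) := Fintype.ofFinite _
  have h12 : q₁ + q₂ ≠ 0 := fun h ↦ hq₂1 (by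
    have : q₂ = -q₁ := eq_neg_of_add_eq_zero_right h
    rw [this, hneg])
  have h12a : q₁ + q₂ ≠ q₁ := fun h ↦ hq₂0 (by simpa using h)
  have h12b : q₁ + q₂ ≠ q₂ := fun h ↦ hq₁ (by simpa using h)
  have hS : ({0, q₁, q₂, q₁ + q₂} : Finset (X ⧸ K₀)).card = 4 := by
    rw [Finset.card_insert_of_notMem, Finset.card_insert_of_notMem, Finset.card_pair h12b.symm]
    · simp only [Finset.mem_insert, Finset.mem_singleton, not_or]; exact ⟨hq₂1.symm, h12a.symm⟩
    · simp only [Finset.mem_insert, Finset.mem_singleton, not_or]; exact ⟨hq₁.symm, hq₂0.symm, h12.symm⟩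
  have huniv : ({0, q₁, q₂, q₁ + q₂} : Finset (X ⧸ K₀)) = Finset.univ := by
    apply Finset.eq_univ_of_card
    rw [hS]
    refine le_antisymm ?_ ?_
    · rw [← hS]; exact Finset.card_le_univ _
    · rw [Fintype.card_eq_nat_card]; exact hcard
  have hq : q ∈ ({0, q₁, q₂, q₁ + q₂} : Finset (X ⧸ K₀)) := by rw [huniv]; exact Finset.mem_univ q
  simpa only [Finset.mem_insert, Finset.mem_singleton] using hq

end Elementary

/-! ## §2. A balanced pairing with trivial left kernel bounds `|M/IM|` by `|M[I]|` -/

section Pairing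

variable {R M : Type*} [CommRing R] [AddCommGroup M] [Module R M]

/-- **`|M/IM| ≤ |M[I]|` from a balanced pairing.** `M` a finite `R`-module killed by `2`, `B : M × M → ℤ/2` biadditive with
`B(t x, y) = B(x, t y)` (`t ∈ R`) and trivial left kernel. Then `x ↦ B(x,·)` is a bijection `M → Hom(M, ℤ/2)`
(`natCard_addMonoidHom_zmod_two`), `B(x,·)` kills `IM` iff `x ∈ M[I]`, and `|M/IM| = |Hom(M/IM, ℤ/2)| ≤ |M[I]|`.
[cite: DarmonDiamondTaylor1995, §4.5 (p. 134)] -/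
theorem natCard_quotient_smul_top_le_of_pairing [Finite M] (h2 : ∀ x : M, (2 : ℕ) • x = 0)
    (B : M →+ (M →+ ZMod 2)) (hbal : ∀ (t : R) (x y : M), B (t • x) y = B x (t • y))
    (hleft : ∀ x : M, B x = 0 → x = 0) (I : Ideal R) :
    Nat.card (M ⧸ (I • ⊤ : Submodule R M)) ≤ Nat.card {x : M // ∀ t ∈ I, t • x = 0} := by
  classical
  set N : Submodule R M := I • ⊤ with hN
  -- `B` is a bijection onto `Hom(M, ℤ/2)`
  have hBinj : Function.Injective B := fun x y h ↦ sub_eq_zero.mp (hleft _ (by rw [map_sub, h, sub_self]))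
  haveI : Finite (M →+ ZMod 2) := Finite.of_injective (fun f : M →+ ZMod 2 ↦ (⇑f : M → ZMod 2)) DFunLike.coe_injective
  have hBbij : Function.Bijective B :=
    hBinj.bijective_of_nat_card_le (natCard_addMonoidHom_zmod_two h2).le
  -- the quotient is killed by `2`, so `|M/N| = |Hom(M/N, ℤ/2)|`
  haveI : Finite (M ⧸ N) := Finite.of_surjective _ (Submodule.Quotient.mk_surjective N)
  have h2Q : ∀ q : M ⧸ N, (2 : ℕ) • q = 0 := fun q ↦ by
    obtain ⟨x, rfl⟩ := Submodule.Quotient.mk_surjective N q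
    rw [← Submodule.mkQ_apply, ← map_nsmul, h2 x, map_zero]
  rw [← natCard_addMonoidHom_zmod_two h2Q]
  -- `ψ ↦ x_ψ` with `B x_ψ = ψ ∘ mk`, an injection `Hom(M/N, ℤ/2) → M[I]`
  have hkill : ∀ x : M, (∀ n ∈ N, B x n = 0) → ∀ t ∈ I, t • x = 0 := fun x hx t ht ↦ by
    apply hleft
    ext y
    rw [hbal, AddMonoidHom.zero_apply]
    exact hx _ (Submodule.smul_mem_smul ht Submodule.mem_top)
  let F : (M ⧸ N →+ ZMod 2) → {x : M // ∀ t ∈ I, t • x = 0} := fun ψ ↦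
    ⟨(hBbij.2 (ψ.comp N.mkQ.toAddMonoidHom)).choose, hkill _ fun n hn ↦ by
      rw [(hBbij.2 (ψ.comp N.mkQ.toAddMonoidHom)).choose_spec, AddMonoidHom.comp_apply,
        LinearMap.toAddMonoidHom_coe, Submodule.mkQ_apply, (Submodule.Quotient.mk_eq_zero N).mpr hn, map_zero]⟩
  have hF : Function.Injective F := by
    intro ψ₁ ψ₂ h
    have hx : (hBbij.2 (ψ₁.comp N.mkQ.toAddMonoidHom)).choose = (hBbij.2 (ψ₂.comp N.mkQ.toAddMonoidHom)).choose :=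
      congrArg Subtype.val h
    have hc : ψ₁.comp N.mkQ.toAddMonoidHom = ψ₂.comp N.mkQ.toAddMonoidHom := by
      rw [← (hBbij.2 (ψ₁.comp N.mkQ.toAddMonoidHom)).choose_spec,
        ← (hBbij.2 (ψ₂.comp N.mkQ.toAddMonoidHom)).choose_spec, hx]
    ext q
    obtain ⟨x, rfl⟩ := Submodule.Quotient.mk_surjective N q
    have := DFunLike.congr_fun hc x
    simpa using this
  exact Nat.card_le_card_of_injective F hF

end Pairing

/-! ## §3. Four cosets of `𝔪Λ` in `Λ = H₁(X₀(L), ℤ)` from multiplicity one (sub form) and self-duality -/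

section PeriodHomology

variable {L : ℕ} [NeZero L]

/-- Hecke elements act `ℂ`-linearly on the dual space: `t • (c • v) = c • (t • v)`. [folklore] -/
theorem heckeRing0_smul_complex_smul (t : HeckeRing0 L 2) (c : ℂ) (v : Module.Dual ℂ (CuspForm (Gamma0 L) 2)) :
    t • (c • v) = c • (t • v) := by
  change HeckeRing0.dualAction L 2 t (c • v) = c • HeckeRing0.dualAction L 2 t v
  exact map_smul _ c v

/-- Membership in `𝔪 • ⊤ ≤ Λ` (as a `𝕋`-submodule of the type `Λ`) is membership of the underlying functional in
`𝔪 • Λ` (as a submodule of the dual space). [folklore] -/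
theorem mem_ideal_smul_top_iff (𝔪 : Ideal (HeckeRing0 L 2)) (z : periodHomologyHecke L) :
    z ∈ (𝔪 • ⊤ : Submodule (HeckeRing0 L 2) (periodHomologyHecke L)) ↔
      (z : Module.Dual ℂ (CuspForm (Gamma0 L) 2)) ∈ 𝔪 • periodHomologyHecke L := by
  have hmap : Submodule.map (periodHomologyHecke L).subtype (𝔪 • ⊤ : Submodule (HeckeRing0 L 2) (periodHomologyHecke L)) =
      𝔪 • periodHomologyHecke L := by
    rw [Submodule.map_smul'', Submodule.map_top, Submodule.range_subtype]
  constructor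
  · intro hz
    rw [← hmap]
    exact Submodule.mem_map_of_mem hz
  · intro hz
    rw [← hmap] at hz
    obtain ⟨z', hz', e⟩ := hz
    have : z' = z := Subtype.ext e
    exact this ▸ hz'

/-- **B4 (four cosets of `𝔪Λ`) from multiplicity one in SUB form and the Hecke self-duality of `J₀(L)[2]`.** Let
`𝔪 ∋ 2` be a maximal ideal of `𝕋 = HeckeRing0 L 2` with `|𝕋/𝔪| = 2` and `dim_{𝕋/𝔪} J₀(L)[𝔪] = 2` (the conclusion of
`buzzard2000_multiplicityOne_gamma0`), and let `B` be a `𝕋`-balanced pairing on `J₀(L)[2]` with trivial left kernel (the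
content of `heckeSelfDual_torsionBy_J0` at `ℓ = 2`). Then `Λ = periodHomology L` lies in the four `𝔪Λ`-cosets of
`0, v₁, v₂, v₁ + v₂` for some `v₁, v₂ ∈ Λ` — i.e. `|Λ/𝔪Λ| ≤ 4`, the QUOTIENT form B4 consumed by `kTwo_of_fourCosets_of_facts`.
Chain: `Λ/𝔪Λ ↪ M/𝔪M` (`M = J₀(L)[2]`, `x ↦ [x/2]`, kernel `2Λ ⊆ 𝔪Λ`), `|M/𝔪M| ≤ |M[𝔪]| = |𝕋/𝔪|² = 4`.
[cite: DarmonDiamondTaylor1995, §1.6 Lemma 1.38 and §4.5 Thm. 4.26] -/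
theorem exists_fourCosets_periodHomology_of_multiplicityOne (𝔪 : Ideal (HeckeRing0 L 2)) [h𝔪 : 𝔪.IsMaximal]
    (h2 : (2 : HeckeRing0 L 2) ∈ 𝔪) (hq : Nat.card (HeckeRing0 L 2 ⧸ 𝔪) = 2)
    (hsub : Module.finrank (HeckeRing0 L 2 ⧸ 𝔪) (Submodule.torsionBySet (HeckeRing0 L 2) (J0 L) 𝔪) = 2)
    (B : Submodule.torsionBy (HeckeRing0 L 2) (J0 L) ((2 : ℕ) : HeckeRing0 L 2) →+
      (Submodule.torsionBy (HeckeRing0 L 2) (J0 L) ((2 : ℕ) : HeckeRing0 L 2) →+ ZMod 2))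
    (hbal : ∀ (t : HeckeRing0 L 2) x y, B (t • x) y = B x (t • y)) (hleft : ∀ x, (∀ y, B x y = 0) → x = 0) :
    ∃ v₁ ∈ periodHomology L, ∃ v₂ ∈ periodHomology L, ∀ x ∈ periodHomology L,
      x ∈ 𝔪 • periodHomologyHecke L ∨ x - v₁ ∈ 𝔪 • periodHomologyHecke L ∨
      x - v₂ ∈ 𝔪 • periodHomologyHecke L ∨ x - (v₁ + v₂) ∈ 𝔪 • periodHomologyHecke L := by
  classical
  haveI hMfin : Finite (Submodule.torsionBy (HeckeRing0 L 2) (J0 L) ((2 : ℕ) : HeckeRing0 L 2)) := J0.finite_torsionBy L (ℓ := 2) two_ne_zero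
  have h22 : ((2 : ℕ) : HeckeRing0 L 2) = 2 := Nat.cast_ofNat
  -- (1) `(Submodule.torsionBy (HeckeRing0 L 2) (J0 L) ((2 : ℕ) : HeckeRing0 L 2))` is killed by `2`
  have h2M : ∀ x : (Submodule.torsionBy (HeckeRing0 L 2) (J0 L) ((2 : ℕ) : HeckeRing0 L 2)), (2 : ℕ) • x = 0 := fun x ↦ by
    have hx := x.2
    rw [Submodule.mem_torsionBy_iff] at hx
    apply Subtype.ext
    rw [AddSubgroupClass.coe_nsmul, ZeroMemClass.coe_zero, ← Nat.cast_smul_eq_nsmul (HeckeRing0 L 2)]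
    exact hx
  -- (2) `|(Submodule.torsionBy (HeckeRing0 L 2) (J0 L) ((2 : ℕ) : HeckeRing0 L 2))/𝔪(Submodule.torsionBy (HeckeRing0 L 2) (J0 L) ((2 : ℕ) : HeckeRing0 L 2))| ≤ |(Submodule.torsionBy (HeckeRing0 L 2) (J0 L) ((2 : ℕ) : HeckeRing0 L 2))[𝔪]|`
  have hleft' : ∀ x : (Submodule.torsionBy (HeckeRing0 L 2) (J0 L) ((2 : ℕ) : HeckeRing0 L 2)), B x = 0 → x = 0 := fun x hx ↦ hleft x fun y ↦ by rw [hx, AddMonoidHom.zero_apply]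
  have hle := natCard_quotient_smul_top_le_of_pairing h2M B hbal hleft' 𝔪
  -- (3) `|(Submodule.torsionBy (HeckeRing0 L 2) (J0 L) ((2 : ℕ) : HeckeRing0 L 2))[𝔪]| = |J₀(L)[𝔪]| = |𝕋/𝔪|² = 4`
  have htors_le : Submodule.torsionBySet (HeckeRing0 L 2) (J0 L) 𝔪 ≤ (Submodule.torsionBy (HeckeRing0 L 2) (J0 L) ((2 : ℕ) : HeckeRing0 L 2)) := by
    rw [h22]
    exact J0.torsionBySet_le_torsionBy L h2
  let e : {x : (Submodule.torsionBy (HeckeRing0 L 2) (J0 L) ((2 : ℕ) : HeckeRing0 L 2)) // ∀ t ∈ 𝔪, t • x = 0} ≃ Submodule.torsionBySet (HeckeRing0 L 2) (J0 L) 𝔪 :=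
    { toFun := fun x ↦ ⟨(x.1 : J0 L), (Submodule.mem_torsionBySet_iff _ _).mpr fun t ↦ by
        have h := congrArg Subtype.val (x.2 t t.2)
        exact h⟩
      invFun := fun j ↦ ⟨⟨(j : J0 L), htors_le j.2⟩, fun t ht ↦ Subtype.ext
        ((Submodule.mem_torsionBySet_iff _ _).mp j.2 ⟨t, ht⟩)⟩
      left_inv := fun x ↦ rfl
      right_inv := fun j ↦ rfl }
  haveI : Finite (Submodule.torsionBySet (HeckeRing0 L 2) (J0 L) 𝔪) := J0.finite_torsionBySet L two_ne_zero (by rw [← h22] at h2; exact h2)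
  letI : Field (HeckeRing0 L 2 ⧸ 𝔪) := Ideal.Quotient.field 𝔪
  haveI : Module.Finite (HeckeRing0 L 2 ⧸ 𝔪) (Submodule.torsionBySet (HeckeRing0 L 2) (J0 L) 𝔪) := Module.Finite.of_finite
  have hcard4 : Nat.card {x : (Submodule.torsionBy (HeckeRing0 L 2) (J0 L) ((2 : ℕ) : HeckeRing0 L 2)) // ∀ t ∈ 𝔪, t • x = 0} = 4 := by
    rw [Nat.card_congr e, Module.natCard_eq_pow_finrank (K := HeckeRing0 L 2 ⧸ 𝔪), hq, hsub]
    norm_num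
  -- (4) the `𝕋`-linear map `Λ → (Submodule.torsionBy (HeckeRing0 L 2) (J0 L) ((2 : ℕ) : HeckeRing0 L 2))`, `x ↦ [x/2]`
  let D : (periodHomologyHecke L) →ₗ[HeckeRing0 L 2] (Submodule.torsionBy (HeckeRing0 L 2) (J0 L) ((2 : ℕ) : HeckeRing0 L 2)) :=
    { toFun := fun x ↦ ⟨J0.divMap L 2 ⟨x, (mem_periodHomologyHecke L).mp x.2⟩, by
        rw [Submodule.mem_torsionBy_iff, Nat.cast_smul_eq_nsmul]
        exact J0.nsmul_divMap L 2 _⟩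
      map_add' := fun x y ↦ by
        apply Subtype.ext
        change J0.divMap L 2 ⟨(x : Module.Dual ℂ (CuspForm (Gamma0 L) 2)) + (y : Module.Dual ℂ (CuspForm (Gamma0 L) 2)), _⟩ =
          J0.divMap L 2 _ + J0.divMap L 2 _
        rw [← map_add]
        rfl
      map_smul' := fun t x ↦ by
        apply Subtype.ext
        change Submodule.Quotient.mk ((2 : ℂ)⁻¹ • (t • (x : Module.Dual ℂ (CuspForm (Gamma0 L) 2)))) =
          t • Submodule.Quotient.mk ((2 : ℂ)⁻¹ • (x : Module.Dual ℂ (CuspForm (Gamma0 L) 2)))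
        rw [← Submodule.Quotient.mk_smul, heckeRing0_smul_complex_smul] }
  have hDval : ∀ x : (periodHomologyHecke L), ((D x : (Submodule.torsionBy (HeckeRing0 L 2) (J0 L) ((2 : ℕ) : HeckeRing0 L 2))) : J0 L) = Submodule.Quotient.mk ((2 : ℂ)⁻¹ • (x : Module.Dual ℂ _)) := fun x ↦ rfl
  -- `D` is onto `(Submodule.torsionBy (HeckeRing0 L 2) (J0 L) ((2 : ℕ) : HeckeRing0 L 2))`
  have hDsurj : Function.Surjective D := by
    intro m
    have hm : (m : J0 L) ∈ Submodule.torsionBy (HeckeRing0 L 2) (J0 L) (2 : ℕ) := m.2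
    obtain ⟨y, hy⟩ := J0.mem_range_divMap L two_ne_zero hm
    refine ⟨⟨y, (mem_periodHomologyHecke L).mpr y.2⟩, Subtype.ext ?_⟩
    rw [← hy]
    rfl
  -- kernel of `D` lies in `𝔪 • ⊤` (it is `2Λ`)
  have hDker : ∀ z : (periodHomologyHecke L), D z = 0 → z ∈ (𝔪 • ⊤ : Submodule (HeckeRing0 L 2) (periodHomologyHecke L)) := by
    intro z hz
    have hz' : Submodule.Quotient.mk (p := periodHomologyHecke L) ((2 : ℂ)⁻¹ • (z : Module.Dual ℂ _)) = 0 := by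
      rw [← hDval, hz]; rfl
    rw [Submodule.Quotient.mk_eq_zero] at hz'
    -- `z = 2 • w` with `w = z/2 ∈ Λ`
    have hzw : z = (2 : HeckeRing0 L 2) • (⟨(2 : ℂ)⁻¹ • (z : Module.Dual ℂ _), hz'⟩ : (periodHomologyHecke L)) := by
      apply Subtype.ext
      rw [Submodule.coe_smul, show (2 : HeckeRing0 L 2) = ((2 : ℕ) : HeckeRing0 L 2) from h22.symm, Nat.cast_smul_eq_nsmul,
        ← Nat.cast_smul_eq_nsmul ℂ, smul_smul]
      norm_num
    rw [hzw]
    exact Submodule.smul_mem_smul h2 Submodule.mem_top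
  -- (5) the induced map on quotients is injective, so `|Λ/𝔪Λ| ≤ |(Submodule.torsionBy (HeckeRing0 L 2) (J0 L) ((2 : ℕ) : HeckeRing0 L 2))/𝔪(Submodule.torsionBy (HeckeRing0 L 2) (J0 L) ((2 : ℕ) : HeckeRing0 L 2))| ≤ 4`
  have hmaple : Submodule.map D (𝔪 • ⊤ : Submodule (HeckeRing0 L 2) (periodHomologyHecke L)) = (𝔪 • ⊤ : Submodule (HeckeRing0 L 2) (Submodule.torsionBy (HeckeRing0 L 2) (J0 L) ((2 : ℕ) : HeckeRing0 L 2))) := by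
    rw [Submodule.map_smul'', Submodule.map_top, LinearMap.range_eq_top.mpr hDsurj]
  have hinj : ∀ x : (periodHomologyHecke L), D x ∈ (𝔪 • ⊤ : Submodule (HeckeRing0 L 2) (Submodule.torsionBy (HeckeRing0 L 2) (J0 L) ((2 : ℕ) : HeckeRing0 L 2))) → x ∈ (𝔪 • ⊤ : Submodule (HeckeRing0 L 2) (periodHomologyHecke L)) := by
    intro x hx
    rw [← hmaple] at hx
    obtain ⟨y, hy, hyx⟩ := hx
    have hker : D (x - y) = 0 := by rw [map_sub, hyx, sub_self]
    have := hDker _ hker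
    have e : x = y + (x - y) := by abel
    rw [e]
    exact add_mem hy this
  let Dq : ((periodHomologyHecke L) ⧸ (𝔪 • ⊤ : Submodule (HeckeRing0 L 2) (periodHomologyHecke L))) →ₗ[HeckeRing0 L 2] ((Submodule.torsionBy (HeckeRing0 L 2) (J0 L) ((2 : ℕ) : HeckeRing0 L 2)) ⧸ (𝔪 • ⊤ : Submodule (HeckeRing0 L 2) (Submodule.torsionBy (HeckeRing0 L 2) (J0 L) ((2 : ℕ) : HeckeRing0 L 2)))) :=
    Submodule.mapQ _ _ D (fun y hy ↦ by rw [Submodule.mem_comap, ← hmaple]; exact Submodule.mem_map_of_mem hy)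
  have hDq : Function.Injective Dq := by
    rw [← LinearMap.ker_eq_bot, Submodule.eq_bot_iff]
    intro q hq
    obtain ⟨x, rfl⟩ := Submodule.Quotient.mk_surjective _ q
    rw [LinearMap.mem_ker, Submodule.mapQ_apply, Submodule.Quotient.mk_eq_zero] at hq
    exact (Submodule.Quotient.mk_eq_zero _).mpr (hinj x hq)
  haveI : Finite ((Submodule.torsionBy (HeckeRing0 L 2) (J0 L) ((2 : ℕ) : HeckeRing0 L 2)) ⧸ (𝔪 • ⊤ : Submodule (HeckeRing0 L 2) (Submodule.torsionBy (HeckeRing0 L 2) (J0 L) ((2 : ℕ) : HeckeRing0 L 2)))) := Finite.of_surjective _ (Submodule.Quotient.mk_surjective _)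
  haveI hPfin : Finite ((periodHomologyHecke L) ⧸ (𝔪 • ⊤ : Submodule (HeckeRing0 L 2) (periodHomologyHecke L))) := Finite.of_injective Dq hDq
  have hcardP : Nat.card ((periodHomologyHecke L) ⧸ (𝔪 • ⊤ : Submodule (HeckeRing0 L 2) (periodHomologyHecke L))) ≤ 4 :=
    (Nat.card_le_card_of_injective Dq hDq).trans (hle.trans hcard4.le)
  -- (6) four cosets in the type `Λ`, then in the ambient dual space
  haveI : Finite ((periodHomologyHecke L) ⧸ (𝔪 • ⊤ : Submodule (HeckeRing0 L 2) (periodHomologyHecke L)).toAddSubgroup) := hPfin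
  obtain ⟨v₁, v₂, hv⟩ := exists_fourCosets_of_natCard_quotient_le_four
    (𝔪 • ⊤ : Submodule (HeckeRing0 L 2) (periodHomologyHecke L)).toAddSubgroup (fun x ↦ by
      rw [Submodule.mem_toAddSubgroup, ← Nat.cast_smul_eq_nsmul (HeckeRing0 L 2), h22]
      exact Submodule.smul_mem_smul h2 Submodule.mem_top) hcardP
  refine ⟨v₁, (mem_periodHomologyHecke L).mp v₁.2, v₂, (mem_periodHomologyHecke L).mp v₂.2, fun x hx ↦ ?_⟩
  have key := hv ⟨x, (mem_periodHomologyHecke L).mpr hx⟩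
  simp only [Submodule.mem_toAddSubgroup, mem_ideal_smul_top_iff] at key
  simpa using key

end PeriodHomology

/-! ## §4. (K2) from B4 in SUB form, the self-duality pairing, and the named facts -/

section KTwo

open Literature.NumberTheory.EllipticCurves.Rank1Residual

/-- **(K2) at the depleted level from mod-`2` multiplicity one in SUB form.** Hypotheses of
`…StarKTwo.kTwo_of_fourCosets_of_facts` with its four-cosets input replaced by: `𝔪₀ = span{2, T_q − a_q(W) (q ∤ L),
T_ℓ (ℓ ∣ L)}` is maximal with `|𝕋/𝔪₀| = 2`, `dim_{𝕋/𝔪₀} J₀(L)[𝔪₀] = 2` (conclusion shape of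
`buzzard2000_multiplicityOne_gamma0`), and a `𝕋`-balanced pairing on `J₀(L)[2]` with trivial left kernel (content of
`heckeSelfDual_torsionBy_J0` at `ℓ = 2`). Conclusion: every additive subgroup `K` of `S₂(Γ₀(L))^∨` containing `2x`,
`T_q^∨x − a_q(W)x` (`q ∤ L`), `U_ℓ^∨x` (`ℓ ∣ L`) (`x ∈ Λ`) and the cusp-negation differences has `x, y ∈ Λ ∖ K ⇒ x − y ∈ K`.
[cite: DarmonDiamondTaylor1995, §1.6 Lemma 1.38 and §4.5 Thm. 4.26] -/
theorem kTwo_of_multiplicityOneSub_of_facts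
    (hES : eichlerShimura_depletedOptimalQuotient_periodLattice)
    (hF : WeierstrassCurve.isIsogenous_iff_frobeniusTrace_eq) (hMK : mazurKenku_exists_cyclic_isogeny)
    (W : WeierstrassCurve ℚ) [W.IsElliptic] [W.IsGloballyMinimal] (hss : GoodSS W 2) (hΔ : W.Δ < 0)
    {N : ℕ} [NeZero N] {f : CuspForm (Gamma0 N) 2} (hf : IsNewformOf W f)
    (S : Finset ℕ) (hS : ∀ ℓ ∈ S, ℓ.Prime) (hSne : S.Nonempty) (hSN : ∀ q : ℕ, q.Prime → q ∣ N → q ∈ S)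
    (L : ℕ) [NeZero L] (hL : L = N * ∏ ℓ ∈ S, ℓ ^ 2)
    [h𝔪 : (Ideal.span ({t : HeckeRing0 L 2 | t = 2 ∨ (∃ (q : ℕ) (hq : q.Prime), ¬ q ∣ L ∧
          t = HeckeRing0.T L 2 q hq - (W.LFunction q : HeckeRing0 L 2)) ∨ (∃ (q : ℕ) (hq : q.Prime), q ∣ L ∧
          t = HeckeRing0.T L 2 q hq)})).IsMaximal]
    (hq : Nat.card (HeckeRing0 L 2 ⧸ Ideal.span ({t : HeckeRing0 L 2 | t = 2 ∨ (∃ (q : ℕ) (hq : q.Prime), ¬ q ∣ L ∧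
          t = HeckeRing0.T L 2 q hq - (W.LFunction q : HeckeRing0 L 2)) ∨ (∃ (q : ℕ) (hq : q.Prime), q ∣ L ∧
          t = HeckeRing0.T L 2 q hq)})) = 2)
    (hsub : Module.finrank (HeckeRing0 L 2 ⧸ Ideal.span ({t : HeckeRing0 L 2 | t = 2 ∨ (∃ (q : ℕ) (hq : q.Prime), ¬ q ∣ L ∧
          t = HeckeRing0.T L 2 q hq - (W.LFunction q : HeckeRing0 L 2)) ∨ (∃ (q : ℕ) (hq : q.Prime), q ∣ L ∧
          t = HeckeRing0.T L 2 q hq)}))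
      (Submodule.torsionBySet (HeckeRing0 L 2) (J0 L) (Ideal.span ({t : HeckeRing0 L 2 | t = 2 ∨
          (∃ (q : ℕ) (hq : q.Prime), ¬ q ∣ L ∧ t = HeckeRing0.T L 2 q hq - (W.LFunction q : HeckeRing0 L 2)) ∨
          (∃ (q : ℕ) (hq : q.Prime), q ∣ L ∧ t = HeckeRing0.T L 2 q hq)}))) = 2)
    (B : Submodule.torsionBy (HeckeRing0 L 2) (J0 L) ((2 : ℕ) : HeckeRing0 L 2) →+
      (Submodule.torsionBy (HeckeRing0 L 2) (J0 L) ((2 : ℕ) : HeckeRing0 L 2) →+ ZMod 2))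
    (hbal : ∀ (t : HeckeRing0 L 2) x y, B (t • x) y = B x (t • y)) (hleft : ∀ x, (∀ y, B x y = 0) → x = 0)
    (K : AddSubgroup (Module.Dual ℂ (CuspForm (Gamma0 L) 2)))
    (h2K : ∀ x ∈ periodHomology L, (2 : ℂ) • x ∈ K)
    (hTK : ∀ (q : ℕ) (hq : q.Prime), ¬ q ∣ L → ∀ x ∈ periodHomology L,
      (haveI : NeZero q := ⟨hq.ne_zero⟩; heckeT (Gamma0 L) 2 q).dualMap x - (W.LFunction q : ℂ) • x ∈ K)
    (hUK : ∀ (q : ℕ) (hq : q.Prime), q ∣ L → ∀ x ∈ periodHomology L,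
      (haveI : NeZero q := ⟨hq.ne_zero⟩; heckeT (Gamma0 L) 2 q).dualMap x ∈ K)
    (hcK : ∀ γ : Gamma0 L, periodFunctional L ⟨iotaConj (γ : SL(2, ℤ)), iotaConj_coe_mem_gamma0 γ⟩ - periodFunctional L γ ∈ K)
    {x y : Module.Dual ℂ (CuspForm (Gamma0 L) 2)} (hx : x ∈ periodHomology L) (hy : y ∈ periodHomology L)
    (hxK : x ∉ K) (hyK : y ∉ K) : x - y ∈ K := by
  have h2 : (2 : HeckeRing0 L 2) ∈ Ideal.span ({t : HeckeRing0 L 2 | t = 2 ∨ (∃ (q : ℕ) (hq : q.Prime), ¬ q ∣ L ∧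
      t = HeckeRing0.T L 2 q hq - (W.LFunction q : HeckeRing0 L 2)) ∨ (∃ (q : ℕ) (hq : q.Prime), q ∣ L ∧
      t = HeckeRing0.T L 2 q hq)}) := Ideal.subset_span (Or.inl rfl)
  obtain ⟨v₁, -, v₂, hv₂, hcos⟩ := exists_fourCosets_periodHomology_of_multiplicityOne _ h2 hq hsub B hbal hleft
  exact kTwo_of_fourCosets_of_facts hES hF hMK W hss hΔ hf S hS hSne hSN L hL hv₂ hcos K h2K hTK hUK hcK hx hy hxK hyK

end KTwo




end Summit.BirchSwinnertonDyer.BirchSwinnertonDyer.Theorems.ThetaLayerLambdaCongruenceAtTwo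

end
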